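import Summits.RiemannHypothesis.RiemannHypothesis.Theorems.TiltedLandingLaw421R3NewtonDoorGenusOne
import Summits.RiemannHypothesis.RiemannHypothesis.Theorems.TiltedLandingLaw421R3PurseHalf

/-! # TiltedLandingLaw421 — round 3 SUCC^B STEP 2: the ANTI-ESCAPE SPLIT (four landed doors ⨝ ONE law; v7, namespace `RhW08.AntiEscapeSplit7`)

HELPER module for crux `TiltedLandingLaw421R` (stmt 33346), stub `stub_restSuccBotQ` of the registered skeleton
`Cruxes/TiltedLandingLaw421R/Lines/trkD_v4q.lean`.  It closes NOTHING open: it re-expresses the OPEN node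
`RhW08.SuccSplit.AntiEscapeCore` (`…R3AntiEscapeIso`) as ONE availability law `DoorAvailLawQ` over FOUR landed doors,
and records the by-name chain `DoorAvailLawQ → AntiEscapeCore → AntiEscape → RestSuccBotQ` and
`DoorAvailLawQ → RestRateBotPQ halfPurse → Law421P halfPurse`.

* §0 THE NEWTON DOOR FROM PRIMITIVE DATA is C3 g41's landed join, used BY NAME:
  `RhW08.NewtonDoorGenusOne.succ_of_newton_door_genusOne_frame` (`…R3NewtonDoorGenusOne`) =
  `Literature.Analysis.Complex.GenusOneLogDerivC3g41.twoPoint_bound_dslope` (`…R3GenusOneLogDeriv3`: Hadamard genus one applied to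
  the cofactor `h := dslope f^{(j)} v`) ⨝ `RhW08.NewtonDoor.succ_of_newton_door_twoPointU` (`…R3NewtonDoor4`, C1 g28), with the analytic
  inputs (entirety, growth of exponent `< 2`, `f^{(j)}(v) = 0`) discharged from the legal frame.  The socket «S1» of the endgame map is
  thereby DISCHARGED BY NAME; this file adds no analysis.
* §1 THE SOCKETS — predicates on the zero configuration of `f^{(j)}` at the lowest state `v` (and, for the cluster
  door only, on `f^{(j+1)}` along ONE circle against a model PINNED to the zeros of `f^{(j)}`); none mentions a level-`(j+1)` state:
  `NewtonNumbers f x₀ R Hs j v` (canonical field value `newtonK f j v = h'(v)/h(v)`, a radius number `ρ₀`, the offset,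
  `δ`-separation of the cofactor zeros from the inflated Newton disc, the INTRINSIC END zero-sum, the slack — EXACTLY
  the door data of `RhW08.NewtonDoorGenusOne.succ_of_newton_door_genusOne_frame`), `ClusterNumbersJ f x₀ R Hs j` ((CA423): a near zero
  list `S` of `f^{(j)}` with multiplicities CONFINED to a real-centred disc (critic g23's P1 against near-list absorption; v7 = (CA430):
  the v6 radius cap `ρ ≤ Hs` is DROPPED — inside the column `|Re u − x₀| ≤ R/2` a level-`(j+1)` state has NO height clause
  (`RhW08.Column.stTrkDQ_of_column`), so the landed door's own depth clause is the right ceiling), `f^{(j)} = Q·h` with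
  `Q := nearPoly S m`, the far cofactor `h` zero-free on the closed disc, the PINNED tilted model `M := Q′ + K·Q`, the count
  `zcountNReal f^{(j)} + 2 ≤ zcountN M` and Rouché domination of `f^{(j+1)}` by `M·h` on one circle; the LAW uses its
  field-variation twin `ClusterNumbersJ'` (`‖Q‖·‖h′ − K·h‖ < ‖M‖·‖h‖` on the
  circle, no level-`(j+1)` symbol; `clusterNumbersJ_iff`, referee desk g28's sharpening) — the data of D1 = the band-deep
  tilted cluster door `RhW08.ClusterQM.tiltClusterLawQB_of_realBound`
  over the real pigeonhole `RealCritBoundNSig` (S2, closed by name by C4 g29; a hypothesis here); the unpinned free-model form is NOT a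
  socket: referee desk g28's costume test cfab3da9), `CornerWindow f x₀ R Hs j` (EXACTLY those of D2
  `RhW08.ClusterQM.antiEscape_instance_of_window_corners`, whose `¬ ReadyR2` is a binder of `AntiEscapeCore`), and (v7, (CA429)/(CA430))
  `NewtonNumbersCol f x₀ R Hs j` (Newton numbers at ANY upper zero of `f^{(j)}` in the column, made a state by
  `RhW08.Column.stTrkDQ_of_column`) and `ClusterNumbersU f x₀ R j` (the PINNED, CONFINED socket of the UPPER MODEL DOOR D3
  `RhW08.ClusterQM.succ_of_upper_model_zero_pt`: complex centre, disc off the axis and in the column, `S` confined to it, `M := Q′ + K·Q`,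
  ONE model zero inside, domination on the circle — the two-zero midpoint mechanism (Grace–Heawood / Walsh) of C2 ADD-8 / C6 ADD-159,
  and with `S = {c}` the column Newton step without height slack).
* §2 THE LAW `DoorAvailLawQ` (OPEN, v7 — the NAMED RESIDUAL-CANDIDATE of the SUCC half; v6's three-door text was WITHDRAWN by (CA430)
  on C6 ADD-159's in-model no-door cells R0 «roof contact» and C2 ADD-8's plateau cells Q2/Q5/Q6, all at `j = 0`): under the binders of
  `AntiEscapeCore` and simplicity of `v` (`f^{(j+1)}(v) ≠ 0`; the multiple case is free by `RhW08.NewtonDoor.succ_of_multiple`) one of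
  the FIVE sockets holds.  Each is a quantity the census engines print; none mentions a level-`(j+1)` state.
* §3 COMPOSITION, door by door: `succ_of_newtonNumbersWith`, `succ_of_newtonNumbers`, `succ_of_newtonNumbersCol`,
  `succ_of_clusterNumbersJ`, `succ_of_clusterNumbersJ'` (via `deriv_sub_model_eq`, `variation_iff_domination`, `clusterNumbersJ_iff`),
  `succ_of_clusterNumbersU`, `succ_of_cornerWindow`; ★ `antiEscapeCore_of_doorAvail : RealCritBoundNSig → DoorAvailLawQ → AntiEscapeCore`;
  `antiEscape_of_doorAvail`; ★ `restSuccBotQ_of_doorAvail : RealCritBoundNSig → DoorAvailLawQ → RestSuccBotQ` (the statement of `stub_restSuccBotQ`, through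
  `restSuccBotQ_of_pieces dimpleSig_holds (antiEscape_of_core _)`); `law421Half_of_doorAvail_rate :
  RealCritBoundNSig → DoorAvailLawQ → RestRateBotPQ halfPurse → Law421P halfPurse` (the crux text at `κ = ½`, through
  `law421Half_of_succ_rate`).  `RealCritBoundNSig` is closed by name (C4 g29 `RhW08.RealCrit.realCritBound_all`, to land as
  `…R3RealCrit`); it is a hypothesis here only to keep this file independent of that landing.

Negative edges honoured (no re-filing): no fixed window, no lineage or margin law, no tilt-domination law as LAW, no
`K₀ = 0` cluster law, no mid-field door (vacuous under `DiscOverlap`: `MidFieldParams` forces `Z(f^{(j)}) = {v, v̄}`), no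
Landau far-field pricing, no height monotonicity; every door PRODUCES the successor state from level-`j` data (no abstract
escape exclusion, no costume law of the shape «…LawQ → AntiEscapeCore» with a level-`(j+1)` state inside the law).

Nothing here bears on the truth of RH; RH is not proved; `TiltedLandingLaw421R` (33346), `AntiEscapeCore` and
`DoorAvailLawQ` are OPEN. -/

namespace RhW08.AntiEscapeSplit7

open Complex Set
open scoped ComplexConjugate
open Literature.Analysis.Complex
open Summit.RiemannHypothesis.RiemannHypothesis.Theorems.Splittings.JensenWindow
open RhIdea6.G17.W07C7 RhIdea6.G17.W07C7.Rev6 RhIdea6.G18.W07C8.Law421BirthS RhIdea6.G19.W07C11.Seam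
open RhIdea6.G20.W07C12.Frac RhIdea6.G20.W07C12.StColP RhW07.C12.FieldSplit RhIdea6.G21.W07C13.TentMax
open RhW07.C14.TwoSided RhW07.C14.Classes RhW07.C14.Lineage RhW07.C14.Booking
open RhW07.C13.Heredity RhIdea6.G22.W07C15pre.Injection RhW07.E3.Cell RhW07.E3.Lit
open RhW08.Round1 RhW08.StSwap RhW08.Round2 RhW08.QuadW RhW08.SealSwapQ RhW08.SealSwap RhW08.SuccB RhW08.SuccSplit
open RhW08.SuccTheft RhW08.Column RhW08.Hurwitz RhW08.ClusterQ RhW08.ClusterQM RhW08.NewtonDoor RhW08.NewtonDoorGenusOne RhW08.PurseP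

/-! ## §1 The sockets: numbers on the zero configuration of `f^{(j)}` at the lowest state (no level-`(j+1)` state mentioned) -/

/-- The CANONICAL NEWTON FIELD VALUE at `v`: `K := h'(v)/h(v)` for the cofactor `h := dslope f^{(j)} v` (informally, for a simple
zero `v` of `F := f^{(j)}`: `h(v) = F'(v)`, `h'(v) = F''(v)/2`, so `K = f^{(j+2)}(v)/(2 f^{(j+1)}(v))` = the conjugate of the field
the OTHER zeros of `f^{(j)}` exert at `v`). -/
noncomputable def newtonK (f : ℂ → ℂ) (j : ℕ) (v : ℂ) : ℂ :=
  deriv (dslope (iteratedDeriv j f) v) v / dslope (iteratedDeriv j f) v v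

/-- NEWTON NUMBERS with explicit data `(K, ρ₀, δ)` at `(j, v)` — exactly the door data of `succ_of_newton_door_genusOne_frame`:
`K ≠ 0`; `‖K‖·Im v > 1`; `0 < ρ₀`; the Newton disc `D(v − K⁻¹, ρ₀/‖K‖)` stays off the real axis (`ρ₀/‖K‖ ≤ |Im(v − K⁻¹)|`); `0 < δ`;
every zero `c` of the cofactor `dslope f^{(j)} v` satisfies `(1+ρ₀)/‖K‖ + δ ≤ ‖v − c‖`; the INTRINSIC END number
`(1+ρ₀)·((1+ρ₀)/‖K‖ · Σ'_c ord(c)/((‖v−c‖ − (1+ρ₀)/‖K‖)·‖v−c‖)) < ρ₀·‖K‖` (sum over ALL `c : ℂ`, weighted by the order of the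
cofactor at `c`, zero off its zero set); and the SLACK `(ρ_N(v) + (1+ρ₀)/‖K‖)² + (j+1)(Im v + (1+ρ₀)/‖K‖)² ≤ (j+1)·Hs²` with
`ρ_N = RhW08.NewtonDoor.rhoN x₀ R v = max(|Re v − x₀| − R/2, 0)`. -/
def NewtonNumbersWith (f : ℂ → ℂ) (x₀ R Hs : ℝ) (j : ℕ) (v K : ℂ) (ρ₀ δ : ℝ) : Prop :=
  K ≠ 0 ∧ 1 < ‖K‖ * v.im ∧ 0 < ρ₀ ∧ ρ₀ / ‖K‖ ≤ |(v - K⁻¹).im| ∧ 0 < δ ∧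
    (∀ c : ℂ, dslope (iteratedDeriv j f) v c = 0 → (1 + ρ₀) / ‖K‖ + δ ≤ ‖v - c‖) ∧
    (1 + ρ₀) * ((1 + ρ₀) / ‖K‖ * ∑' c : ℂ, (analyticOrderNatAt (dslope (iteratedDeriv j f) v) c : ℝ) /
        ((‖v - c‖ - (1 + ρ₀) / ‖K‖) * ‖v - c‖)) < ρ₀ * ‖K‖ ∧
    (rhoN x₀ R v + (1 + ρ₀) / ‖K‖) ^ 2 + ((j : ℝ) + 1) * (v.im + (1 + ρ₀) / ‖K‖) ^ 2 ≤ ((j : ℝ) + 1) * Hs ^ 2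

/-- ★ SOCKET «Newton»: NEWTON NUMBERS at `(j, v)` for the CANONICAL field value `newtonK f j v` and SOME radius number `ρ₀ > 0` and
separation `δ > 0`. -/
def NewtonNumbers (f : ℂ → ℂ) (x₀ R Hs : ℝ) (j : ℕ) (v : ℂ) : Prop :=
  ∃ ρ₀ δ : ℝ, NewtonNumbersWith f x₀ R Hs j v (newtonK f j v) ρ₀ δ

/-- The NEAR POLYNOMIAL of a finite zero list `S` with multiplicities `m`: `Q := Π_{a ∈ S} (X − a)^{m a}`. -/
noncomputable def nearPoly (S : Finset ℂ) (m : ℂ → ℕ) : Polynomial ℂ :=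
  ∏ a ∈ S, (Polynomial.X - Polynomial.C a) ^ m a

/-- The TILTED NEAR MODEL `Q′ + K·Q` (a polynomial; `K` = the far field's logarithmic derivative frozen to a constant). -/
noncomputable def tiltModel (S : Finset ℂ) (m : ℂ → ℕ) (K : ℂ) : Polynomial ℂ :=
  Polynomial.derivative (nearPoly S m) + Polynomial.C K * nearPoly S m

/-- ★ SOCKET «cluster, level-j pinned» ((CA423); the free-model form was struck as a relabelling by the referee's costume test
cfab3da9 — with `M := f^{(j+1)}, h := 1` it held wherever an in-band non-real zero of `f^{(j+1)}` exists).  ALL data are level-`j`: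
a disc `D(a, ρ)` with REAL centre, `0 < ρ` (v7: NO radius cap — the depth clause below is the ceiling, (CA430)), and a finite zero list
`S` CONFINED TO THE CLOSED DISC (P1: `∀ u ∈ S, ‖u − a‖ ≤ ρ`;
critic g23's near-list absorption b98bf5b7 — an unconfined `S` swallows the far field — is thereby impossible) with multiplicities `m`
and the factorisation `F = Q·h`, `F := f^{(j)}`, `Q := nearPoly S m`, `h` entire and zero-free on the closed disc (so `h = F/Q` is the
FAR cofactor carrying EVERY zero outside the disc, and `(S, m)` is EXACTLY the zero multiset of `F` in `D̄(a, ρ)`: for `u ∈ S`,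
`ord_F(u) = m u` since `h(u) ≠ 0`, and a zero of `F` in the closed disc lies in `S` since `h ≠ 0` there); a tilt constant `K`
(e.g. `K := (h′/h)(a)`, or C3's dslope field value);
the PINNED MODEL `M := Q′ + K·Q = tiltModel S m K`; and the clauses: `0 < ρ`; the depth clause of the band-deep tilted door
`RhW08.ClusterQM.tiltClusterLawQB_of_realBound` verbatim; the COUNT `zcountNReal F a ρ + 2 ≤ zcountN M a ρ` (real zeros of `F` in
the disc `+ 2 ≤` zeros of the explicit polynomial `M` in the disc); Rouché domination `‖f^{(j+1)} − M·h‖ < ‖M·h‖` on the circle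
`‖z − a‖ = ρ` — since `F′ − M·h = Q·h·(h′/h − K)` it is implied by the checkable field-variation inequality
`‖h′/h − K‖·‖Q‖ < ‖Q′ + K·Q‖` on the circle. -/
def ClusterNumbersJ (f : ℂ → ℂ) (x₀ R Hs : ℝ) (j : ℕ) : Prop :=
  ∃ (S : Finset ℂ) (m : ℂ → ℕ) (K : ℂ) (h : ℂ → ℂ) (a ρ : ℝ), 0 < ρ ∧ (∀ u ∈ S, ‖u - (a : ℂ)‖ ≤ ρ) ∧
    Differentiable ℂ h ∧
    (∀ z : ℂ, iteratedDeriv j f z = (nearPoly S m).eval z * h z) ∧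
    (∀ z : ℂ, ‖z - (a : ℂ)‖ ≤ ρ → h z ≠ 0) ∧
    (|a - x₀| + ρ ≤ R / 2 ∨ (max (|a - x₀| + ρ - R / 2) 0) ^ 2 + ((j : ℝ) + 1) * ρ ^ 2 ≤ ((j : ℝ) + 1) * Hs ^ 2) ∧
    zcountNReal (iteratedDeriv j f) a ρ + 2 ≤ zcountN (fun z => (tiltModel S m K).eval z) a ρ ∧
    ∀ z : ℂ, ‖z - (a : ℂ)‖ = ρ →
      ‖iteratedDeriv (j + 1) f z - (tiltModel S m K).eval z * h z‖ < ‖(tiltModel S m K).eval z * h z‖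

/-- The model defect is the near polynomial times the field variation: `F′ − (Q′ + K·Q)·h = Q·(h′ − K·h)` when `F = Q·h`. -/
theorem deriv_sub_model_eq {F h : ℂ → ℂ} {S : Finset ℂ} {m : ℂ → ℕ} (K : ℂ) (hh : Differentiable ℂ h)
    (hfac : ∀ z : ℂ, F z = (nearPoly S m).eval z * h z) (z : ℂ) :
    deriv F z - (tiltModel S m K).eval z * h z = (nearPoly S m).eval z * (deriv h z - K * h z) := by
  have hF : F = fun w => (nearPoly S m).eval w * h w := funext hfac
  have hd : deriv F z = (Polynomial.derivative (nearPoly S m)).eval z * h z + (nearPoly S m).eval z * deriv h z := by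
    rw [hF]; exact (((nearPoly S m).hasDerivAt z).mul (hh z).hasDerivAt).deriv
  have hM : (tiltModel S m K).eval z = (Polynomial.derivative (nearPoly S m)).eval z + K * (nearPoly S m).eval z := by
    simp [tiltModel, Polynomial.eval_add, Polynomial.eval_mul, Polynomial.eval_C]
  rw [hd, hM]; ring

/-- Field variation ⟺ Rouché domination by the pinned model, pointwise (referee desk g28's `dom_iff_variation`, cert 52831868). -/
theorem variation_iff_domination {f : ℂ → ℂ} {j : ℕ} {h : ℂ → ℂ} {S : Finset ℂ} {m : ℂ → ℕ} (K : ℂ) (hh : Differentiable ℂ h)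
    (hfac : ∀ z : ℂ, iteratedDeriv j f z = (nearPoly S m).eval z * h z) (z : ℂ) :
    ‖(nearPoly S m).eval z‖ * ‖deriv h z - K * h z‖ < ‖(tiltModel S m K).eval z‖ * ‖h z‖ ↔
      ‖deriv (iteratedDeriv j f) z - (tiltModel S m K).eval z * h z‖ < ‖(tiltModel S m K).eval z * h z‖ := by
  rw [deriv_sub_model_eq K hh hfac z, norm_mul, norm_mul]

/-- ★ SOCKET «cluster, level-j pinned» IN FIELD-VARIATION FORM (referee desk g28's textual sharpening; THIS is the law's disjunct):
`ClusterNumbersJ` (with P1) with the domination clause replaced by `‖Q‖·‖h′ − K·h‖ < ‖M‖·‖h‖` on the circle — the genuine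
far-field flatness inequality of ALL zeros outside the disc; NO level-`(j+1)` symbol occurs; equivalent to `ClusterNumbersJ` by
`clusterNumbersJ_iff`. -/
def ClusterNumbersJ' (f : ℂ → ℂ) (x₀ R Hs : ℝ) (j : ℕ) : Prop :=
  ∃ (S : Finset ℂ) (m : ℂ → ℕ) (K : ℂ) (h : ℂ → ℂ) (a ρ : ℝ), 0 < ρ ∧ (∀ u ∈ S, ‖u - (a : ℂ)‖ ≤ ρ) ∧
    Differentiable ℂ h ∧
    (∀ z : ℂ, iteratedDeriv j f z = (nearPoly S m).eval z * h z) ∧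
    (∀ z : ℂ, ‖z - (a : ℂ)‖ ≤ ρ → h z ≠ 0) ∧
    (|a - x₀| + ρ ≤ R / 2 ∨ (max (|a - x₀| + ρ - R / 2) 0) ^ 2 + ((j : ℝ) + 1) * ρ ^ 2 ≤ ((j : ℝ) + 1) * Hs ^ 2) ∧
    zcountNReal (iteratedDeriv j f) a ρ + 2 ≤ zcountN (fun z => (tiltModel S m K).eval z) a ρ ∧
    ∀ z : ℂ, ‖z - (a : ℂ)‖ = ρ →
      ‖(nearPoly S m).eval z‖ * ‖deriv h z - K * h z‖ < ‖(tiltModel S m K).eval z‖ * ‖h z‖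

/-- ★ The two pinned cluster sockets are equivalent (clause by clause; the last by `variation_iff_domination` and `iteratedDeriv_succ`). -/
theorem clusterNumbersJ_iff {f : ℂ → ℂ} {x₀ R Hs : ℝ} {j : ℕ} : ClusterNumbersJ f x₀ R Hs j ↔ ClusterNumbersJ' f x₀ R Hs j := by
  constructor
  · rintro ⟨S, m, K, h, a, ρ, hρ, hS, hh, hfac, hh0, hdepth, hn, hdom⟩
    refine ⟨S, m, K, h, a, ρ, hρ, hS, hh, hfac, hh0, hdepth, hn, fun z hz => (variation_iff_domination K hh hfac z).mpr ?_⟩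
    rw [← iteratedDeriv_succ]
    exact hdom z hz
  · rintro ⟨S, m, K, h, a, ρ, hρ, hS, hh, hfac, hh0, hdepth, hn, hvar⟩
    refine ⟨S, m, K, h, a, ρ, hρ, hS, hh, hfac, hh0, hdepth, hn, fun z hz => ?_⟩
    rw [iteratedDeriv_succ]
    exact (variation_iff_domination K hh hfac z).mp (hvar z hz)

/-- ★ SOCKET «corner window»: exactly the numeric hypotheses of `RhW08.ClusterQM.antiEscape_instance_of_window_corners` at level `j`
— a Jensen window `[α, β] × [−h, h]` of `f^{(j)}` containing a non-real zero of `f^{(j)}`, whose corners satisfy the level-`(j+1)` band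
inequality at height `min h Hs`. -/
def CornerWindow (f : ℂ → ℂ) (x₀ R Hs : ℝ) (j : ℕ) : Prop :=
  ∃ α β h : ℝ, Window (iteratedDeriv j f) α β h ∧
    (∃ u ∈ Ioo α β ×ℂ Ioo (-h) h, iteratedDeriv j f u = 0 ∧ u.im ≠ 0) ∧
    (max (max |α - x₀| |β - x₀| - R / 2) 0) ^ 2 + ((j : ℝ) + 1) * (min h Hs) ^ 2 ≤ ((j : ℝ) + 1) * Hs ^ 2

/-- ★ SOCKET «Newton at any column pair» (v7, (CA429)): Newton numbers at SOME upper zero `c` of `f^{(j)}` in the column `|Re c − x₀| ≤ R/2`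
(such a `c` is a level-`j` state by `RhW08.Column.stTrkDQ_of_column`; the Newton door never uses lowest-ness). -/
def NewtonNumbersCol (f : ℂ → ℂ) (x₀ R Hs : ℝ) (j : ℕ) : Prop :=
  ∃ c : ℂ, iteratedDeriv j f c = 0 ∧ 0 < c.im ∧ |c.re - x₀| ≤ R / 2 ∧ NewtonNumbers f x₀ R Hs j c

/-- ★ SOCKET «upper cluster, level-j pinned and confined» (v7, (CA430): the FOURTH DOOR).  ALL data are level-`j`: a disc `D(c, ρ)` with COMPLEX
centre, OFF the real axis (`0 < ρ ≤ Im c`, so every point of the open disc is in the upper half-plane and no real count is needed) and IN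
THE COLUMN (`|Re c − x₀| + ρ ≤ R/2`, so a zero of `f^{(j+1)}` found inside is a level-`(j+1)` state by column immunity — no height clause);
a finite zero list `S` CONFINED to the closed disc with multiplicities `m`, `F := f^{(j)} = Q·h` with `Q := nearPoly S m` and `h` entire and
zero-free on the closed disc (so `(S, m)` is exactly the zero multiset of `F` there and `h` carries every other zero); a constant `K`
(e.g. `h′/h(c)`; any value incl. `0` is admissible); the PINNED MODEL `M := Q′ + K·Q = tiltModel S m K` with ONE zero in the open disc; and
Rouché domination `‖f^{(j+1)} − M·h‖ < ‖M·h‖` on the circle (equivalently the far-field flatness `‖Q‖·‖h′ − K·h‖ < ‖M‖·‖h‖`, cf.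
`variation_iff_domination`).  With `S = {v, c′}` and `c` near the midpoint this is the two-zero (Grace–Heawood / Walsh) mechanism behind the
successors of C2 ADD-8's plateau cells; with `S = {c′}` it is the column Newton step `M = m·(1 + K′(z − c′))` free of v6's roof slack.
Locality is automatic (`ρ ≤ Im c ≤ Hs`). Exactly the numeric hypotheses of D3 `RhW08.ClusterQM.succ_of_upper_model_zero_pt`. -/
def ClusterNumbersU (f : ℂ → ℂ) (x₀ R : ℝ) (j : ℕ) : Prop :=
  ∃ (S : Finset ℂ) (m : ℂ → ℕ) (K : ℂ) (h : ℂ → ℂ) (c : ℂ) (ρ : ℝ), 0 < ρ ∧ ρ ≤ c.im ∧ |c.re - x₀| + ρ ≤ R / 2 ∧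
    (∀ u ∈ S, ‖u - c‖ ≤ ρ) ∧ Differentiable ℂ h ∧
    (∀ z : ℂ, iteratedDeriv j f z = (nearPoly S m).eval z * h z) ∧
    (∀ z : ℂ, ‖z - c‖ ≤ ρ → h z ≠ 0) ∧
    (∃ z₀ : ℂ, ‖z₀ - c‖ < ρ ∧ (tiltModel S m K).eval z₀ = 0) ∧
    ∀ z : ℂ, ‖z - c‖ = ρ →
      ‖iteratedDeriv (j + 1) f z - (tiltModel S m K).eval z * h z‖ < ‖(tiltModel S m K).eval z * h z‖

/-! ## §2 The law (OPEN, v7): at the lowest state of a stuck non-Ready′ level with disc overlap, one of the four doors is available -/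

/-- ★★★ **DOOR-AVAILABILITY LAW** (OPEN — the NAMED RESIDUAL of the SUCC half).  Legal frame; `v` the LOWEST level-`j` band state;
the level is not Ready′; no all-in-band in-range window at `v`; `v` is not a dimple; some other non-real zero's Jensen disc meets
`v`'s (`DiscOverlap`); and `v` is a SIMPLE zero of `f^{(j)}` (`f^{(j+1)}(v) ≠ 0`).  THEN (v7): Newton numbers at `v`, or Newton numbers at
some column pair, or pinned real-centred cluster numbers at level `j` (field-variation form `ClusterNumbersJ'`), or pinned upper cluster
numbers at level `j` (`ClusterNumbersU`), or a corner-admissible window at level `j`.  (The binders of `AntiEscapeCore` plus simplicity; the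
five disjuncts are the sockets of the four landed doors D4 (twice), D1, D3, D2.  v6's three-door text was WITHDRAWN by (CA430).) -/
def DoorAvailLawQ : Prop :=
  ∀ (η : ℝ) (f : ℂ → ℂ) (x₀ s hmax R Hs : ℝ) (B : ℕ), EngineHyps5 2 η f x₀ s hmax R Hs B → ∀ (j : ℕ) (v : ℂ),
    IsLowest StTrkDQ η f x₀ s hmax R Hs B j v → ¬ ReadyR2 η f x₀ s hmax R Hs B j v →
    ¬ AllInBandInRangeWindow f x₀ R Hs j v → ¬ Dimple f j v → DiscOverlap f j v →
    iteratedDeriv (j + 1) f v ≠ 0 →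
    NewtonNumbers f x₀ R Hs j v ∨ NewtonNumbersCol f x₀ R Hs j ∨ ClusterNumbersJ' f x₀ R Hs j ∨ ClusterNumbersU f x₀ R j ∨
      CornerWindow f x₀ R Hs j

/-! ## §3 Composition: each socket opens its door; the law closes `AntiEscapeCore`, `AntiEscape`, `RestSuccBotQ` -/

/-- DOOR D4 from Newton numbers with explicit data (`K` given in any closed form equal to the canonical value).  The multiple case
`f^{(j+1)}(v) = 0` is `succ_of_multiple`; otherwise `v` is a simple zero (Mathlib `analyticOrderAt_eq_one_of_zero_deriv_ne_zero`)
and `succ_of_newton_door_genusOne_frame` applies. -/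
theorem succ_of_newtonNumbersWith {η : ℝ} {f : ℂ → ℂ} {x₀ s hmax R Hs : ℝ} {B j : ℕ} {v : ℂ}
    (hE : EngineHyps5 2 η f x₀ s hmax R Hs B) (hv : StTrkDQ η f x₀ s hmax R Hs B j v)
    {K : ℂ} {ρ₀ δ : ℝ} (hKdef : K = newtonK f j v) (hN : NewtonNumbersWith f x₀ R Hs j v K ρ₀ δ) :
    ∃ u : ℂ, StTrkDQ η f x₀ s hmax R Hs B (j + 1) u := by
  by_cases hz : iteratedDeriv (j + 1) f v = 0
  · exact succ_of_multiple hE hv hz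
  obtain ⟨hK, hKy, hρ₀, hoff, hδ, hsepZ, hendZ, hslack⟩ := hN
  have hFd : Differentiable ℂ (iteratedDeriv j f) := differentiable_iteratedDeriv_of_entire hE.1 j
  have hv' : StColQ' η f x₀ s hmax R Hs B j v := hv
  obtain ⟨-, hFv, -⟩ := hv'
  have hderiv : deriv (iteratedDeriv j f) v ≠ 0 := by
    rw [← iteratedDeriv_succ]
    exact hz
  have hsimple : analyticOrderAt (iteratedDeriv j f) v = 1 :=
    (hFd.analyticAt v).analyticOrderAt_eq_one_of_zero_deriv_ne_zero hFv hderiv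
  exact succ_of_newton_door_genusOne_frame hE hv hsimple hKdef hK hKy hρ₀ hoff hδ hsepZ hendZ hslack

/-- ★ DOOR D4 from the socket `NewtonNumbers`. -/
theorem succ_of_newtonNumbers {η : ℝ} {f : ℂ → ℂ} {x₀ s hmax R Hs : ℝ} {B j : ℕ} {v : ℂ}
    (hE : EngineHyps5 2 η f x₀ s hmax R Hs B) (hv : StTrkDQ η f x₀ s hmax R Hs B j v) (hN : NewtonNumbers f x₀ R Hs j v) :
    ∃ u : ℂ, StTrkDQ η f x₀ s hmax R Hs B (j + 1) u := by
  obtain ⟨ρ₀, δ, hN⟩ := hN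
  exact succ_of_newtonNumbersWith hE hv rfl hN

/-- DOOR D4 at ANY column pair (v7): the upper zero `c` is a level-`j` state by column immunity, then `succ_of_newtonNumbers` at `c`. -/
theorem succ_of_newtonNumbersCol {η : ℝ} {f : ℂ → ℂ} {x₀ s hmax R Hs : ℝ} {B j : ℕ} {v : ℂ}
    (hE : EngineHyps5 2 η f x₀ s hmax R Hs B) (hv : StTrkDQ η f x₀ s hmax R Hs B j v) (hN : NewtonNumbersCol f x₀ R Hs j) :
    ∃ u : ℂ, StTrkDQ η f x₀ s hmax R Hs B (j + 1) u := by
  obtain ⟨c, hc0, hcim, hccol, hNc⟩ := hN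
  have hv' : StColQ' η f x₀ s hmax R Hs B j v := hv
  exact succ_of_newtonNumbers hE (stTrkDQ_of_column hE hv'.1 hc0 hcim hccol) hNc

/-- ★ DOOR D1 from the pinned socket `ClusterNumbersJ` at a non-Ready′ level: the band-deep TILTED CLUSTER DOOR
`RhW08.ClusterQM.tiltClusterLawQB_of_realBound` fed the `DominatedModel` triple `(Q, h, M) := (nearPoly S m, h, tiltModel S m K)`
(polynomial functions are entire; the model count is `n := zcountN M a ρ` itself), over the real pigeonhole `RealCritBoundNSig`
(S2: closed by name by C4 g29's `RhW08.RealCrit.realCritBound_all`, landing as `…R3RealCrit`; taken here as a hypothesis so that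
this file does not depend on that landing order). -/
theorem succ_of_clusterNumbersJ (hRB : RealCritBoundNSig) {η : ℝ} {f : ℂ → ℂ} {x₀ s hmax R Hs : ℝ} {B j : ℕ} {v : ℂ}
    (hE : EngineHyps5 2 η f x₀ s hmax R Hs B) (hv : StTrkDQ η f x₀ s hmax R Hs B j v) (hnR : ¬ ReadyR2 η f x₀ s hmax R Hs B j v)
    (hC : ClusterNumbersJ f x₀ R Hs j) : ∃ u : ℂ, StTrkDQ η f x₀ s hmax R Hs B (j + 1) u := by
  obtain ⟨S, m, K, h, a, ρ, hρ, -, hh, hfac, hh0, hdepth, hn, hdom⟩ := hC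
  refine tiltClusterLawQB_of_realBound hRB hE hv hnR hρ hdepth
    ⟨fun z => (nearPoly S m).eval z, h, fun z => (tiltModel S m K).eval z, Polynomial.differentiable _, hh,
      Polynomial.differentiable _, hfac, hh0, rfl, fun z hz => ?_⟩ hn
  rw [← iteratedDeriv_succ]
  exact hdom z hz

/-- ★ DOOR D1 from the field-variation socket `ClusterNumbersJ'` (through `clusterNumbersJ_iff`). -/
theorem succ_of_clusterNumbersJ' (hRB : RealCritBoundNSig) {η : ℝ} {f : ℂ → ℂ} {x₀ s hmax R Hs : ℝ} {B j : ℕ} {v : ℂ}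
    (hE : EngineHyps5 2 η f x₀ s hmax R Hs B) (hv : StTrkDQ η f x₀ s hmax R Hs B j v) (hnR : ¬ ReadyR2 η f x₀ s hmax R Hs B j v)
    (hC : ClusterNumbersJ' f x₀ R Hs j) : ∃ u : ℂ, StTrkDQ η f x₀ s hmax R Hs B (j + 1) u :=
  succ_of_clusterNumbersJ hRB hE hv hnR (clusterNumbersJ_iff.mpr hC)

/-- ★ DOOR D3 from the pinned upper socket `ClusterNumbersU` (v7): `RhW08.ClusterQM.succ_of_upper_model_zero_pt` with the polynomial model
`tiltModel S m K` (not identically zero: it dominates strictly at a point of the circle) and the band inequality on the open disc discharged by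
the column clause (the aperture term vanishes; the height term is `|Im z| ≤ Hs` itself). -/
theorem succ_of_clusterNumbersU {η : ℝ} {f : ℂ → ℂ} {x₀ s hmax R Hs : ℝ} {B j : ℕ} {v : ℂ}
    (hE : EngineHyps5 2 η f x₀ s hmax R Hs B) (hv : StTrkDQ η f x₀ s hmax R Hs B j v) (hU : ClusterNumbersU f x₀ R j) :
    ∃ u : ℂ, StTrkDQ η f x₀ s hmax R Hs B (j + 1) u := by
  obtain ⟨S, m, K, h, c, ρ, hρ, hoff, hcol, -, hh, hfac, hh0, hMz, hdom⟩ := hU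
  have hcim : 0 < c.im := lt_of_lt_of_le hρ hoff
  have hoff' : ρ ≤ |c.im| := by rwa [abs_of_pos hcim]
  have hMne : (fun z : ℂ => (tiltModel S m K).eval z) ≠ 0 := by
    intro h0
    have h1 := hdom (c + (ρ : ℂ)) (by rw [add_sub_cancel_left, Complex.norm_real, Real.norm_eq_abs, abs_of_pos hρ])
    have h2 : (tiltModel S m K).eval (c + (ρ : ℂ)) = 0 := congrFun h0 (c + (ρ : ℂ))
    rw [h2, zero_mul, sub_zero, norm_zero] at h1
    exact absurd h1 (not_lt.2 (norm_nonneg _))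
  refine succ_of_upper_model_zero_pt hE hv hρ hoff' hh (Polynomial.differentiable _) hMne hh0 hdom hMz ?_
  intro z hz hzim
  have hre : |z.re - x₀| ≤ R / 2 := by
    have h1 : |(z - c).re| ≤ ‖z - c‖ := Complex.abs_re_le_norm _
    simp only [Complex.sub_re] at h1
    have h2 : |z.re - x₀| ≤ |z.re - c.re| + |c.re - x₀| := by
      have := abs_add_le (z.re - c.re) (c.re - x₀); rwa [show z.re - c.re + (c.re - x₀) = z.re - x₀ by ring] at this
    linarith
  have hmax : max (|z.re - x₀| - R / 2) 0 = 0 := max_eq_right (by linarith)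
  rw [hmax]
  have hsq : z.im ^ 2 ≤ Hs ^ 2 := by
    have := sq_abs z.im
    rw [← this]
    exact pow_le_pow_left₀ (abs_nonneg _) hzim 2
  have hj : (0 : ℝ) ≤ (j : ℝ) + 1 := by positivity
  nlinarith [mul_le_mul_of_nonneg_left hsq hj]

/-- ★ DOOR D2 from the socket `CornerWindow` at a non-Ready′ level (`RhW08.ClusterQM.antiEscape_instance_of_window_corners`). -/
theorem succ_of_cornerWindow {η : ℝ} {f : ℂ → ℂ} {x₀ s hmax R Hs : ℝ} {B j : ℕ} {v : ℂ}
    (hE : EngineHyps5 2 η f x₀ s hmax R Hs B) (hv : StTrkDQ η f x₀ s hmax R Hs B j v) (hnR : ¬ ReadyR2 η f x₀ s hmax R Hs B j v)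
    (hW : CornerWindow f x₀ R Hs j) :
    ∃ u : ℂ, StTrkDQ η f x₀ s hmax R Hs B (j + 1) u := by
  obtain ⟨α, β, h, hWin, hJ, hcorner⟩ := hW
  exact antiEscape_instance_of_window_corners hE hv hnR hWin hJ hcorner

/-- ★★ **THE SPLIT**: the door-availability law closes `AntiEscapeCore` (multiple zero: `succ_of_multiple`; otherwise the law names
an available door and the door yields the successor state). -/
theorem antiEscapeCore_of_doorAvail (hRB : RealCritBoundNSig) (hL : DoorAvailLawQ) : AntiEscapeCore := by
  intro η f x₀ s hmax R Hs B hE j v hlow hnR hwin hdim hov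
  by_cases hz : iteratedDeriv (j + 1) f v = 0
  · exact succ_of_multiple hE hlow.1 hz
  rcases hL η f x₀ s hmax R Hs B hE j v hlow hnR hwin hdim hov hz with hN | hNc | hC | hU | hW
  · exact succ_of_newtonNumbers hE hlow.1 hN
  · exact succ_of_newtonNumbersCol hE hlow.1 hNc
  · exact succ_of_clusterNumbersJ' hRB hE hlow.1 hnR hC
  · exact succ_of_clusterNumbersU hE hlow.1 hU
  · exact succ_of_cornerWindow hE hlow.1 hnR hW

/-- ★ `RealCritBoundNSig → DoorAvailLawQ → AntiEscape` (through the landed narrowing `antiEscape_of_core`). -/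
theorem antiEscape_of_doorAvail (hRB : RealCritBoundNSig) (hL : DoorAvailLawQ) : AntiEscape :=
  antiEscape_of_core (antiEscapeCore_of_doorAvail hRB hL)

/-- ★★ `RealCritBoundNSig → DoorAvailLawQ → RestSuccBotQ` = the statement of `stub_restSuccBotQ` (skeleton `trkD_v4q`), through
`restSuccBotQ_of_pieces dimpleSig_holds`; with S2 landed, `restSuccBotQ_of_doorAvail realCritBoundNSig_holds : DoorAvailLawQ → RestSuccBotQ`. -/
theorem restSuccBotQ_of_doorAvail (hRB : RealCritBoundNSig) (hL : DoorAvailLawQ) : RestSuccBotQ :=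
  restSuccBotQ_of_pieces dimpleSig_holds (antiEscape_of_doorAvail hRB hL)

/-- ★ THE CRUX TEXT AT `κ = ½` FROM THE TWO NAMED RESIDUALS (over the closed-by-name pigeonhole S2): `DoorAvailLawQ` (SUCC half) and
`RestRateBotPQ halfPurse` (RATE half, = `stub_restRateBotQP`) give `Law421P halfPurse` by `law421Half_of_succ_rate`. -/
theorem law421Half_of_doorAvail_rate (hRB : RealCritBoundNSig) (hL : DoorAvailLawQ) (hR : RestRateBotPQ halfPurse) :
    Law421P halfPurse :=
  law421Half_of_succ_rate (restSuccBotQ_of_doorAvail hRB hL) hR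

end RhW08.AntiEscapeSplit7
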